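import Summits.Ventures.LatticeQCDFlow.Scoring.ChainLagProductACovIID
import Summits.Ventures.LatticeQCDFlow.Scoring.ChainScorerTauIntStudentisedCLT
import Summits.Ventures.LatticeQCDFlow.Scoring.ChainPrintedBarCalibration

/-!
# WHITE NOISE: for the independent sampler `τ_W = ½`, the asymptotic variance of `τ̂_W` is EXACTLY
# `σ²_ℓ = W` (Bartlett), the honest bar is asymptotically exact, and the printed Madras–Sokal bar has
# calibration number `ρ = 1 + 1/(2W)` — it over-covers, by a factor `√(1 + 1/(2W))` in width

HONEST FRAMING: exact (Metropolis-corrected) sampling algorithms for lattice gauge theory;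
figures of merit are autocorrelation/cost numbers at stated couplings and volumes; no
continuum-physics claim.

Venture `LatticeQCDFlow` (cell pub-lqcd), sub-topic `Scoring`; FANOUT row 16 (`su2-base`), GEN-10.
NEW WORK of the cell, not a published result; no definition is introduced; nothing is cited as a fact
(Bartlett 1946: `Var τ̂_W ≈ W/N` for white noise — NAMED ONLY; here it is a theorem about the cell's own
objects).  THE CALIBRATION CASE of the law-of-the-error packet, in numbers: for the INDEPENDENT sampler
(`κ = const π`, the scorers' planted i.i.d. control) and any bounded observable `f` with `Var_π f ≠ 0`,
read through `f̄ = f − ∫ f dπ`: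
(i) the windowed truth is `τ_W = ½` for every `W`; (ii) the gradient of the ratio map at the white-noise
autocovariances is `ℓ = (0, 1/v, …, 1/v)` (`v = Var_π f`); (iii) with GEN-10's diagonal Bartlett matrix
(`Scoring/ChainLagProductACovIID`) the asymptotic variance of `√N (τ̂_W − ½)` is `σ²_ℓ = ℓᵀ Σ ℓ = W`
— so the packet's hypothesis `σ²_ℓ > 0` HOLDS here for every `W ≥ 1` (non-vacuity), and GEN-10's fully
empirical studentised CLT gives `√N (τ̂^A_W − ½)/σ̂_{A,N} ⇒ N(0,1)` for i.i.d. data from every initial law;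
(iv) the printed bar's calibration number is `ρ = (4W+2) τ_W²/σ²_ℓ = 1 + 1/(2W) ≥ 1`: on white noise the
printed Madras–Sokal interval is asymptotically CONSERVATIVE, with coverage limit `N(0, W/(W + ½))([−z, z])`
(e.g. `W = 5`: variance `10/11`, the bar is `√1.1 ≈ 4.9 %` too wide).

## Content (`π` a probability law; `|f| ≤ C` measurable, `v = Var_π f = autocov (const π) π f̄ 0 ≠ 0`;
## `W ≥ 1` where stated; `μ₀` ANY initial law of the i.i.d. chain `P_{μ₀, const π}`)

* `autocov_constKernel_centred` — `C(t) = v · 1{t = 0}` for `f̄`; `tauIntWindow_whiteNoise` — `τ_W = ½`;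
* `tauHatGrad_whiteNoise_zero` / `_succ` — `ℓ_0 = 0`, `ℓ_{t+1} = 1/v`;
* **`tauIntVar_whiteNoise`** — `Σ_s Σ_t ℓ_s ℓ_t Σ(s,t) = W`;
* **`tendstoInDistribution_iid_scorer_studentized_tauIntWindow`** — the fully empirical studentised CLT
  for i.i.d. data (`W ≥ 1`): `√N (τ̂^A_W − ½) (√σ̂²_{A,N})⁻¹ ⇒ N(0, 1)` from every initial law;
* **`iid_printedBar_coverage_limit`** — the printed bar's coverage → `N(0, W/((4W+2)/4))([−z,z])` and
  `nominal_le_iid_printedBar_limit` — it is `≥ N(0,1)([−z, z])`.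

NOT CLAIMED: non-constant kernels; `W = 0` (then `τ̂_0 = ½` identically and `σ²_ℓ = 0`); rates.
-/

noncomputable section

open MeasureTheory ProbabilityTheory Filter Finset Preorder WithLp Set
open scoped ENNReal NNReal Topology RealInnerProductSpace
open Summit.Ventures.LatticeQCDFlow.Exactness Summit.Ventures.LatticeQCDFlow.Exactness.GeneralNCMC

namespace Summit.Ventures.LatticeQCDFlow.Scoring

variable {S : Type*} [MeasurableSpace S] (π : Measure S) [IsProbabilityMeasure π]

/-! ## White-noise algebra: `τ_W = ½`, `ℓ = (0, 1/v, …, 1/v)`, `σ²_ℓ = W` -/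

section Algebra

/-- The centred observable's white-noise autocovariances: `C(t) = v · 1{t = 0}`,
`v = autocov (const π) π f̄ 0 = ∫ f̄² dπ`. -/
theorem autocov_constKernel_centred {f : S → ℝ} (hf : Measurable f) {C : ℝ} (hC : ∀ z, |f z| ≤ C)
    (t : ℕ) :
    autocov (Kernel.const S π) π (fun z => f z - ∫ z', f z' ∂π) t
      = if t = 0 then autocov (Kernel.const S π) π (fun z => f z - ∫ z', f z' ∂π) 0 else 0 := by
  obtain ⟨hgm, hgC, hg0⟩ := centred_observable_bounds π hf hC
  rw [autocov_constKernel π hgm hgC hg0 t, autocov_constKernel π hgm hgC hg0 0, if_pos rfl]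

/-- **`τ_W = ½` for white noise**, every `W`. -/
theorem tauIntWindow_whiteNoise {f : S → ℝ} (hf : Measurable f) {C : ℝ} (hC : ∀ z, |f z| ≤ C)
    (W : ℕ) :
    tauIntWindow (fun t => autocov (Kernel.const S π) π (fun z => f z - ∫ z', f z' ∂π) t
      / autocov (Kernel.const S π) π (fun z => f z - ∫ z', f z' ∂π) 0) W = 1 / 2 := by
  unfold tauIntWindow
  rw [Finset.sum_eq_zero fun t _ => ?_, add_zero]
  beta_reduce
  rw [autocov_constKernel_centred π hf hC (t + 1), if_neg (Nat.succ_ne_zero t), zero_div]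

/-- The gradient's time-`0` coordinate vanishes for white noise: `ℓ_0 = −(Σ_{t≥1} C(t))/C(0)² = 0`. -/
theorem tauHatGrad_whiteNoise_zero {f : S → ℝ} (hf : Measurable f) {C : ℝ} (hC : ∀ z, |f z| ≤ C)
    (W : ℕ) :
    tauHatGrad W (toLp 2 fun u : Fin (W + 1) =>
      autocov (Kernel.const S π) π (fun z => f z - ∫ z', f z' ∂π) u) 0 = 0 := by
  rw [tauHatGrad_coord, if_pos rfl]
  simp only [Fin.val_succ]
  rw [Finset.sum_eq_zero fun t _ => ?_, neg_zero, zero_div]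
  rw [autocov_constKernel_centred π hf hC, if_neg (Nat.succ_ne_zero _)]

omit [IsProbabilityMeasure π] in
/-- The gradient's other coordinates for white noise: `ℓ_{t+1} = 1/v`. -/
theorem tauHatGrad_whiteNoise_succ {f : S → ℝ} (W : ℕ) (t : Fin W) :
    tauHatGrad W (toLp 2 fun u : Fin (W + 1) =>
      autocov (Kernel.const S π) π (fun z => f z - ∫ z', f z' ∂π) u) t.succ
      = 1 / autocov (Kernel.const S π) π (fun z => f z - ∫ z', f z' ∂π) 0 := by
  rw [tauHatGrad_coord, if_neg (Fin.succ_ne_zero t)]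
  simp only [Fin.val_zero]

/-- **`σ²_ℓ = W` FOR WHITE NOISE (Bartlett).**  With `Σ = chainLagACov (const π) π f̄ W` (diagonal,
`Scoring/ChainLagProductACovIID`), `ℓ = tauHatGrad W (C(t))_t` and `Var_π f ≠ 0`:
`Σ_s Σ_t ℓ_s ℓ_t Σ(s,t) = W`. -/
theorem tauIntVar_whiteNoise {f : S → ℝ} (hf : Measurable f) {C : ℝ} (hC : ∀ z, |f z| ≤ C)
    (hσ : autocov (Kernel.const S π) π (fun z => f z - ∫ z', f z' ∂π) 0 ≠ 0) (W : ℕ) :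
    ∑ s : Fin (W + 1), ∑ t : Fin (W + 1),
        tauHatGrad W (toLp 2 fun u : Fin (W + 1) =>
            autocov (Kernel.const S π) π (fun z => f z - ∫ z', f z' ∂π) u) s
          * tauHatGrad W (toLp 2 fun u : Fin (W + 1) =>
            autocov (Kernel.const S π) π (fun z => f z - ∫ z', f z' ∂π) u) t
          * chainLagACov (Kernel.const S π) π (fun z => f z - ∫ z', f z' ∂π) W s t = W := by
  obtain ⟨hgm, hgC, hg0⟩ := centred_observable_bounds π hf hC
  set v := autocov (Kernel.const S π) π (fun z => f z - ∫ z', f z' ∂π) 0 with hv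
  have hv' : v = ∫ z, (f z - ∫ z', f z' ∂π) ^ 2 ∂π := by
    rw [hv, autocov_constKernel π hgm hgC hg0 0, if_pos rfl]
  -- the diagonal matrix kills the off-diagonal sum
  have hdiag : ∀ s : Fin (W + 1), ∑ t : Fin (W + 1),
      tauHatGrad W (toLp 2 fun u : Fin (W + 1) =>
          autocov (Kernel.const S π) π (fun z => f z - ∫ z', f z' ∂π) u) s
        * tauHatGrad W (toLp 2 fun u : Fin (W + 1) =>
          autocov (Kernel.const S π) π (fun z => f z - ∫ z', f z' ∂π) u) t
        * chainLagACov (Kernel.const S π) π (fun z => f z - ∫ z', f z' ∂π) W s t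
      = tauHatGrad W (toLp 2 fun u : Fin (W + 1) =>
          autocov (Kernel.const S π) π (fun z => f z - ∫ z', f z' ∂π) u) s ^ 2
        * (if (s : ℕ) = 0 then ∫ z, ((f z - ∫ z', f z' ∂π) ^ 2 - ∫ z', (f z' - ∫ z'', f z'' ∂π) ^ 2 ∂π) ^ 2 ∂π
          else (∫ z, (f z - ∫ z', f z' ∂π) ^ 2 ∂π) ^ 2) := by
    intro s
    rw [Finset.sum_eq_single s]
    · rw [chainLagACov_constKernel π W hgm hgC hg0 s s, if_pos rfl]
      ring
    · intro t _ hts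
      rw [chainLagACov_constKernel π W hgm hgC hg0 s t, if_neg (Ne.symm hts), mul_zero]
    · intro h; exact absurd (Finset.mem_univ s) h
  simp_rw [hdiag]
  rw [Fin.sum_univ_succ, tauHatGrad_whiteNoise_zero π hf hC W]
  simp only [Fin.val_zero, if_true, zero_pow two_ne_zero, zero_mul, zero_add, Fin.val_succ,
    Nat.succ_ne_zero, if_false, tauHatGrad_whiteNoise_succ, ← hv']
  rw [Finset.sum_const, Finset.card_univ, Fintype.card_fin, nsmul_eq_mul]
  have : (1 / v) ^ 2 * v ^ 2 = 1 := by field_simp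
  rw [this, mul_one]

/-- **The printed bar's calibration number for white noise**: `(4W+2) τ_W² / σ²_ℓ = 1 + 1/(2W)`
(`W ≥ 1`). -/
theorem printedBarCalib_whiteNoise {f : S → ℝ} (hf : Measurable f) {C : ℝ} (hC : ∀ z, |f z| ≤ C)
    (hσ : autocov (Kernel.const S π) π (fun z => f z - ∫ z', f z' ∂π) 0 ≠ 0) {W : ℕ} (hW : 1 ≤ W) :
    (4 * W + 2) * tauIntWindow (fun t => autocov (Kernel.const S π) π (fun z => f z - ∫ z', f z' ∂π) t
          / autocov (Kernel.const S π) π (fun z => f z - ∫ z', f z' ∂π) 0) W ^ 2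
        / ∑ s : Fin (W + 1), ∑ t : Fin (W + 1),
          tauHatGrad W (toLp 2 fun u : Fin (W + 1) =>
              autocov (Kernel.const S π) π (fun z => f z - ∫ z', f z' ∂π) u) s
            * tauHatGrad W (toLp 2 fun u : Fin (W + 1) =>
              autocov (Kernel.const S π) π (fun z => f z - ∫ z', f z' ∂π) u) t
            * chainLagACov (Kernel.const S π) π (fun z => f z - ∫ z', f z' ∂π) W s t
      = 1 + 1 / (2 * W) := by
  rw [tauIntVar_whiteNoise π hf hC hσ W, tauIntWindow_whiteNoise π hf hC W]
  have hW' : (W : ℝ) ≠ 0 := by exact_mod_cast (Nat.one_le_iff_ne_zero.1 hW)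
  field_simp
  ring

end Algebra

/-! ## The packet, instantiated on white noise -/

section Instances

/-- **THE FULLY EMPIRICAL STUDENTISED `τ̂_W` CLT FOR INDEPENDENT DATA.**  For the independent sampler
(`κ = const π`), any bounded observable with `Var_π f ≠ 0`, any `W ≥ 1` and truncations `K_N → ∞`,
`K_N³/N → 0`: from EVERY initial law, `√N (τ̂^A_W − ½) · (√σ̂²_{A,N})⁻¹ ⇒ N(0, 1)` — the packet's
hypotheses `C(0) ≠ 0`, `σ²_ℓ > 0` are discharged (`σ²_ℓ = W`). -/
theorem tendstoInDistribution_iid_scorer_studentized_tauIntWindow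
    {f : S → ℝ} (hf : Measurable f) {C : ℝ} (hC : ∀ z, |f z| ≤ C)
    (hσ : autocov (Kernel.const S π) π (fun z => f z - ∫ z', f z' ∂π) 0 ≠ 0) {W : ℕ} (hW : 1 ≤ W)
    {K : ℕ → ℕ} (hK : Tendsto K atTop atTop) (hK3 : Tendsto (fun N => (K N : ℝ) ^ 3 / N) atTop (𝓝 0))
    (μ₀ : Measure S) [IsProbabilityMeasure μ₀]
    [IsProbabilityMeasure (Kernel.trajMeasure (X := fun _ : ℕ => S) μ₀
        (fun n : ℕ => (Kernel.const S π).comap (fun hh : (i : ↥(Finset.Iic n)) → S =>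
          hh ⟨n, Finset.mem_Iic.2 le_rfl⟩) (measurable_pi_apply _)))] :
    TendstoInDistribution (fun (N : ℕ) (x : ℕ → S) =>
        Real.sqrt N * (tauIntWindow (rhoHat (fun i => f (x i)) N) W - 1 / 2)
          * (Real.sqrt (∑ s : Fin (W + 1), ∑ t : Fin (W + 1),
            tauHatGrad W (toLp 2 fun u : Fin (W + 1) => gammaHat (fun j => f (x j)) N u) s
              * tauHatGrad W (toLp 2 fun u : Fin (W + 1) => gammaHat (fun j => f (x j)) N u) t
              * gammaCross
                  (fun i => (f (x i) - sampleMean (fun j => f (x j)) N)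
                    * (f (x (i + s)) - sampleMean (fun j => f (x j)) N))
                  (fun i => (f (x i) - sampleMean (fun j => f (x j)) N)
                    * (f (x (i + t)) - sampleMean (fun j => f (x j)) N)) N (K N)))⁻¹)
      atTop id (fun _ => Kernel.trajMeasure (X := fun _ : ℕ => S) μ₀
        (fun n : ℕ => (Kernel.const S π).comap (fun hh : (i : ↥(Finset.Iic n)) → S =>
          hh ⟨n, Finset.mem_Iic.2 le_rfl⟩) (measurable_pi_apply _))) (gaussianReal 0 1) := by
  have hpos : 0 < ∑ s : Fin (W + 1), ∑ t : Fin (W + 1),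
      tauHatGrad W (toLp 2 fun u : Fin (W + 1) =>
          autocov (Kernel.const S π) π (fun z => f z - ∫ z', f z' ∂π) u) s
        * tauHatGrad W (toLp 2 fun u : Fin (W + 1) =>
          autocov (Kernel.const S π) π (fun z => f z - ∫ z', f z' ∂π) u) t
        * chainLagACov (Kernel.const S π) π (fun z => f z - ∫ z', f z' ∂π) W s t := by
    rw [tauIntVar_whiteNoise π hf hC hσ W]; exact_mod_cast hW
  have h := tendstoInDistribution_chain_scorer_studentized_tauIntWindow_of_nHit (Kernel.const S π) W
    (invariant_constKernel π) one_ne_zero (minorised_constKernel π) Nat.one_pos hf hC hσ hpos hK hK3 μ₀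
  rw [tauIntWindow_whiteNoise π hf hC W] at h
  exact h

/-- **THE PRINTED MADRAS–SOKAL BAR ON WHITE NOISE**: its coverage probability tends to
`N(0, W/((4W+2) · ¼))([−z, z]) = N(0, W/(W + ½))([−z, z])` (every `W`, every initial law). -/
theorem iid_printedBar_coverage_limit {f : S → ℝ} (hf : Measurable f) {C : ℝ} (hC : ∀ z, |f z| ≤ C)
    (hσ : autocov (Kernel.const S π) π (fun z => f z - ∫ z', f z' ∂π) 0 ≠ 0) (W : ℕ)
    (μ₀ : Measure S) [IsProbabilityMeasure μ₀]
    [IsProbabilityMeasure (Kernel.trajMeasure (X := fun _ : ℕ => S) μ₀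
        (fun n : ℕ => (Kernel.const S π).comap (fun hh : (i : ↥(Finset.Iic n)) → S =>
          hh ⟨n, Finset.mem_Iic.2 le_rfl⟩) (measurable_pi_apply _)))] {z : ℝ} (hz : 0 < z) :
    Tendsto (fun N : ℕ => (Kernel.trajMeasure (X := fun _ : ℕ => S) μ₀
        (fun n : ℕ => (Kernel.const S π).comap (fun hh : (i : ↥(Finset.Iic n)) → S =>
          hh ⟨n, Finset.mem_Iic.2 le_rfl⟩) (measurable_pi_apply _))) {x | |Real.sqrt N
        * (tauIntWindow (rhoHat (fun i => f (x i)) N) W - 1 / 2)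
        * msScale W (tauIntWindow (rhoHat (fun i => f (x i)) N) W)| ≤ z}) atTop
      (𝓝 (gaussianReal 0 ((W : ℝ) / ((4 * W + 2) * (1 / 2) ^ 2)).toNNReal (Icc (-z) z))) := by
  have hτ : tauIntWindow (fun t => autocov (Kernel.const S π) π (fun z => f z - ∫ z', f z' ∂π) t
      / autocov (Kernel.const S π) π (fun z => f z - ∫ z', f z' ∂π) 0) W ≠ 0 := by
    rw [tauIntWindow_whiteNoise π hf hC W]; norm_num
  have h := chain_tendsto_measure_printedBar_calib_of_nHit (Kernel.const S π) W (invariant_constKernel π)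
    one_ne_zero (minorised_constKernel π) Nat.one_pos hf hC hσ hτ μ₀ hz
  rw [tauIntVar_whiteNoise π hf hC hσ W, tauIntWindow_whiteNoise π hf hC W] at h
  exact h

/-- **… and it is conservative**: `N(0,1)([−z, z]) ≤ N(0, W/((4W+2) · ¼))([−z, z])` (`W ≥ 1`, `z ≥ 0`) —
on white noise the printed bar over-covers (variance `W/(W + ½) < 1`). -/
theorem nominal_le_iid_printedBar_limit {W : ℕ} (hW : 1 ≤ W) {z : ℝ} (hz : 0 ≤ z) :
    gaussianReal 0 1 (Icc (-z) z)
      ≤ gaussianReal 0 ((W : ℝ) / ((4 * W + 2) * (1 / 2) ^ 2)).toNNReal (Icc (-z) z) := by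
  refine measure_Icc_gaussianReal_anti ?_ hz
  have hW' : (0 : ℝ) < W := by exact_mod_cast hW
  rw [← NNReal.coe_le_coe, NNReal.coe_one, Real.coe_toNNReal _ (by positivity),
    div_le_one (by positivity)]
  nlinarith

end Instances

end Summit.Ventures.LatticeQCDFlow.Scoring

end
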